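import Summits.ABC.IUTFork.Repair.RHReachLedgerDoorGenuineTiesUnit
import Summits.ABC.IUTFork.Repair.RHReachLedgerQ2GenuineTies
import HarnessLib

/-!
# R-H ROUND 2 Q2(27) — the last arrow with the outer tie read off ONE uniformizer: `LedgerAtDatum T ⟹ T.Cor312NonarchOf` and `K2Target27`
# for Σ₂₇ data whose bad primes satisfy (U) and (O″) «`e ≠ p^a(p−1)`, or per place `f ≥ 2` or a uniformizer passing `‖1 + π^e/p‖ = 1`»

PROOF-ONLY file (0 definitions, 0 `Prop` facts; abc-iut cell, D-0079 RESCUE sub-cell R-H, rung LADDER-ABC:A2.RESCUE.H; ROUND-2 seat abc-iut-rh2-L1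
gen 2, row 27 «reach-ledger»). TAKES NO SIDE on [IUTchIII] Cor. 3.12 or on any author; typed ≠ proved; instantiated ≠ endorsed; nothing here
asserts abc proved or refuted. Row 27's ledger (`HStarReachLedgerK` p464022 / `LedgerAtDatum` p468994) is an R-H CANDIDATE = a HYPOTHESIS SHAPE.

Sequel of `Repair/RHReachLedgerQ2GenuineTies.lean` (p482465) over the widened door `ReachLedgerDoor.statement_pilotDataOfK_of_hStarReachLedgerK_of_innerOuterUnit`
(`Repair/RHReachLedgerDoorGenuineTiesUnit.lean`). PROVED: `cor312NonarchOf_of_ledgerAtDatum_outerUnit(_of_isGalois)` and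
**`k2Target27_of_outerUnit`** / **`k2Target27_of_isGalois_outerUnit`** — `K2Target27` from ONE structural hypothesis on Σ₂₇ data, explicit 1, NO
witness data beyond, at a residue-degree-`1` place over a cyclotomic-index bad prime, ONE uniformizer passing the unit test (decidable from the
residue of `π^e/p`; abc-iut-rh2-q3-num's Q3-TIE27-v1.tsv: at most ONE such (datum, l, type) triple on the 258-datum universe, λ₇ @ `l = 41`,
`p = 1231`, `e_w = 1230`). (I) «odd residue characteristic» is [IUTchI] Def. 3.1 (b) (`Cor312Prov.ne_two_and_ne_l_of_placeOf_mem_S_pilotDataOfK`).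
HONEST SCOPE. `K2Target27` stays OPEN as typed exactly at Σ₂₇ data with a bad prime of cyclotomic index carrying a residue-degree-`1` place of
CYCLOTOMIC TYPE (every uniformizer fails the test; `ℚ_p(ζ_p)`-like: there `log_p(𝒪^×) = 𝔪²` and the ledger's `rOutSharp` column is not the outer
order of the field). OUR typed objects ((Ind2) STRONGER-THAN-PRINT; sharp boxes; volume reading of Step (xi)).
[cite: NeukirchANT1999, Ch. I §9 (9.1), Ch. II (5.5)–(5.7)] [cite: Washington1997, §5.1] [cite: DupuyHilado2025, §1 (1.1), §3.4, §3.9, §4.9]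
[cite: Mochizuki2012, IUTchI Def. 3.1 (b) p. 61, Ex. 3.2 (iv) p. 71; IUTchIII Cor. 3.12 p. 173–174] [claim: Mochizuki2012, status: disputed]
-/

noncomputable section

open Set Function NumberField IsDedekindDomain

namespace Summit.ABC.IUTFork.Repair.RH.ReachLedgerQ2

open Thm311 Thm311.Real Cor312 Cor312Vol Cor312Prov Literature.IUT.LogThetaLattice Literature.IUT.LogVolume
  Literature.IUT.HodgeTheaters Literature.IUT.LogVolume.ThetaData Summit.ABC.IUTFork.Repair.RH.ReachLedger
  Summit.ABC.IUTFork.Repair.RH.ReachLedgerDoor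
open Literature.NumberTheory.DiophantineGeometry Literature.NumberTheory.DiophantineGeometry.GenEll Summit.ABC.ABC.Theorems
  Summit.ABC.IUTFork.Conditional
open scoped Classical

section KFamily

variable
    (M : ∀ (P : NFPoint) (l : ℕ) (T : Cor22.ThetaVolumeDatumAt P l), Type) [∀ P l T, Field (M P l T)] [∀ P l T, NumberField (M P l T)]
    (archPk : ∀ (P : NFPoint) (l : ℕ) (T : Cor22.ThetaVolumeDatumAt P l), letI := T.instFieldF; letI := T.instNumberFieldF; letI := T.instAlgebraF; letI := T.instFieldK;
        letI := T.instNumberFieldK; letI := T.instAlgebraK; letI := T.instFieldFbar; letI := T.instAlgebraFbar;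
        letI := T.instAlgebraKFbar; letI := T.instIsElliptic;
      ∀ (j : (thetaIndex (pilotDataOfK T.D T.K)).Label) (vQ : (thetaIndex (pilotDataOfK T.D T.K)).VQ), Set ((logShellsDH (pilotDataOfK T.D T.K) (analyticLogv T.K)).Packet j vQ))
    (archSub : ∀ (P : NFPoint) (l : ℕ) (T : Cor22.ThetaVolumeDatumAt P l), letI := T.instFieldF; letI := T.instNumberFieldF; letI := T.instAlgebraF; letI := T.instFieldK;
        letI := T.instNumberFieldK; letI := T.instAlgebraK; letI := T.instFieldFbar; letI := T.instAlgebraFbar;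
        letI := T.instAlgebraKFbar; letI := T.instIsElliptic;
      ∀ (j : (thetaIndex (pilotDataOfK T.D T.K)).Label) (v : (thetaIndex (pilotDataOfK T.D T.K)).V), Set ((logShellsDH (pilotDataOfK T.D T.K) (analyticLogv T.K)).Packet j ((thetaIndex (pilotDataOfK T.D T.K)).over v)))
    (Ψ : ∀ (P : NFPoint) (l : ℕ) (T : Cor22.ThetaVolumeDatumAt P l), letI := T.instFieldF; letI := T.instNumberFieldF; letI := T.instAlgebraF; letI := T.instFieldK;
        letI := T.instNumberFieldK; letI := T.instAlgebraK; letI := T.instFieldFbar; letI := T.instAlgebraFbar;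
        letI := T.instAlgebraKFbar; letI := T.instIsElliptic;
      ℤ → ∀ v : (thetaIndex (pilotDataOfK T.D T.K)).V, v ∈ (thetaIndex (pilotDataOfK T.D T.K)).Vbad → Set ((logShellsDH (pilotDataOfK T.D T.K) (analyticLogv T.K)).StarPacket v))
    (act : ∀ (P : NFPoint) (l : ℕ) (T : Cor22.ThetaVolumeDatumAt P l), letI := T.instFieldF; letI := T.instNumberFieldF; letI := T.instAlgebraF; letI := T.instFieldK;
        letI := T.instNumberFieldK; letI := T.instAlgebraK; letI := T.instFieldFbar; letI := T.instAlgebraFbar;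
        letI := T.instAlgebraKFbar; letI := T.instIsElliptic;
      ℤ → ∀ v : (thetaIndex (pilotDataOfK T.D T.K)).V, v ∈ (thetaIndex (pilotDataOfK T.D T.K)).Vbad → (logShellsDH (pilotDataOfK T.D T.K) (analyticLogv T.K)).StarPacket v → Module.End ℚ ((logShellsDH (pilotDataOfK T.D T.K) (analyticLogv T.K)).StarPacket v))
    (Mmod : ∀ (P : NFPoint) (l : ℕ) (T : Cor22.ThetaVolumeDatumAt P l), letI := T.instFieldF; letI := T.instNumberFieldF; letI := T.instAlgebraF; letI := T.instFieldK;
        letI := T.instNumberFieldK; letI := T.instAlgebraK; letI := T.instFieldFbar; letI := T.instAlgebraFbar;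
        letI := T.instAlgebraKFbar; letI := T.instIsElliptic;
      ℤ → ∀ j : (thetaIndex (pilotDataOfK T.D T.K)).LabelStar, Set ((logShellsDH (pilotDataOfK T.D T.K) (analyticLogv T.K)).GlobalPacket j.1))
    (region : ∀ (P : NFPoint) (l : ℕ) (T : Cor22.ThetaVolumeDatumAt P l), letI := T.instFieldF; letI := T.instNumberFieldF; letI := T.instAlgebraF; letI := T.instFieldK;
        letI := T.instNumberFieldK; letI := T.instAlgebraK; letI := T.instFieldFbar; letI := T.instAlgebraFbar;
        letI := T.instAlgebraKFbar; letI := T.instIsElliptic;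
      ℤ → ∀ j : (thetaIndex (pilotDataOfK T.D T.K)).LabelStar, FinDivisor (M P l T) → ∀ vQ : (thetaIndex (pilotDataOfK T.D T.K)).VQ, Set ((logShellsDH (pilotDataOfK T.D T.K) (analyticLogv T.K)).Packet j.1 vQ))
    (n : ∀ (P : NFPoint) (l : ℕ) (T : Cor22.ThetaVolumeDatumAt P l), ℤ)
    {HT : ∀ (P : NFPoint) (l : ℕ) (T : Cor22.ThetaVolumeDatumAt P l), Type} {LogLink : ∀ (P : NFPoint) (l : ℕ) (T : Cor22.ThetaVolumeDatumAt P l), HT P l T → HT P l T → Type}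
    {IsFull : ∀ (P : NFPoint) (l : ℕ) (T : Cor22.ThetaVolumeDatumAt P l), ∀ {s t : HT P l T}, LogLink P l T s t → Prop}
    (lat : ∀ (P : NFPoint) (l : ℕ) (T : Cor22.ThetaVolumeDatumAt P l), LGPGaussianLogThetaLattice (LogLink P l T) (IsFull P l T))
    {Frd : ∀ (P : NFPoint) (l : ℕ) (T : Cor22.ThetaVolumeDatumAt P l), Type} {IsoF : ∀ (P : NFPoint) (l : ℕ) (T : Cor22.ThetaVolumeDatumAt P l), Frd P l T → Frd P l T → Type} {Ob : ∀ (P : NFPoint) (l : ℕ) (T : Cor22.ThetaVolumeDatumAt P l), Frd P l T → Type}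
    {realify : ∀ (P : NFPoint) (l : ℕ) (T : Cor22.ThetaVolumeDatumAt P l), Frd P l T → Frd P l T} {Strip : ∀ (P : NFPoint) (l : ℕ) (T : Cor22.ThetaVolumeDatumAt P l), Type} {IsoS : ∀ (P : NFPoint) (l : ℕ) (T : Cor22.ThetaVolumeDatumAt P l), Strip P l T → Strip P l T → Type}
    {Mv : ∀ (P : NFPoint) (l : ℕ) (T : Cor22.ThetaVolumeDatumAt P l), letI := T.instFieldF; letI := T.instNumberFieldF; letI := T.instAlgebraF; letI := T.instFieldK;
        letI := T.instNumberFieldK; letI := T.instAlgebraK; letI := T.instFieldFbar; letI := T.instAlgebraFbar;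
        letI := T.instAlgebraKFbar; letI := T.instIsElliptic;
      ∀ v : (thetaIndex (pilotDataOfK T.D T.K)).V, v ∈ (thetaIndex (pilotDataOfK T.D T.K)).Vbad → Type}
    [∀ P l T v h, Monoid (Mv P l T v h)]
    (sig : ∀ (P : NFPoint) (l : ℕ) (T : Cor22.ThetaVolumeDatumAt P l), letI := T.instFieldF; letI := T.instNumberFieldF; letI := T.instAlgebraF; letI := T.instFieldK;
        letI := T.instNumberFieldK; letI := T.instAlgebraK; letI := T.instFieldFbar; letI := T.instAlgebraFbar;
        letI := T.instAlgebraKFbar; letI := T.instIsElliptic;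
      GlobalLGPFrobenioidSignature (thetaIndex (pilotDataOfK T.D T.K)).lstar (thetaIndex (pilotDataOfK T.D T.K)).V (· ∈ (thetaIndex (pilotDataOfK T.D T.K)).Vbad) (Frd P l T) (IsoF P l T) (Ob P l T) (realify P l T)
        (Strip P l T) (IsoS P l T) (Mv P l T))
    (split : ∀ (P : NFPoint) (l : ℕ) (T : Cor22.ThetaVolumeDatumAt P l), SplittingMonoids (Mv P l T))
    {ObΔ : ∀ (P : NFPoint) (l : ℕ) (T : Cor22.ThetaVolumeDatumAt P l), Type} {N : ∀ (P : NFPoint) (l : ℕ) (T : Cor22.ThetaVolumeDatumAt P l), letI := T.instFieldF; letI := T.instNumberFieldF; letI := T.instAlgebraF; letI := T.instFieldK;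
        letI := T.instNumberFieldK; letI := T.instAlgebraK; letI := T.instFieldFbar; letI := T.instAlgebraFbar;
        letI := T.instAlgebraKFbar; letI := T.instIsElliptic;
      ∀ v : (thetaIndex (pilotDataOfK T.D T.K)).V, v ∈ (thetaIndex (pilotDataOfK T.D T.K)).Vbad → Type}
    [∀ P l T v h, Monoid (N P l T v h)] (qData : ∀ (P : NFPoint) (l : ℕ) (T : Cor22.ThetaVolumeDatumAt P l), QPilotData (ObΔ P l T) (N P l T))


include M archPk archSub Ψ act Mmod region n lat sig split qData in
/-- **`LedgerAtDatum T ⟹ T.Cor312NonarchOf` with the outer tie read off ONE uniformizer** (per datum; every context of the sharp `K`-setting as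
binders). At every prime `p` UNDER A BAD PLACE `w` of `K = T.K`: (U) uniform fibre, and (O″) `e(𝔭_w∣p) ≠ p^a(p−1)` for all `a`, or for every
`x ∣ p` either `f(𝔭_x∣p) ≥ 2` or some `π ∈ K_x` with `‖π‖ = p^{−1/e}` and `‖1 + π^e/p‖ = 1`. Then `LedgerAtDatum T` implies `T.Cor312NonarchOf`
(abc-iut-rh-typ-10's composition over abc-iut-rh2-L1's widened door). H⋆₂₇ is a HYPOTHESIS; no side taken on [IUTchIII] Cor. 3.12.
[cite: NeukirchANT1999, Ch. II (5.5)–(5.7)] [cite: Mochizuki2012, IUTchI Def. 3.1 (b) p. 61, Ex. 3.2 (iv) p. 71; IUTchIII Cor. 3.12 p. 173–174]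
[cite: DupuyHilado2025, §1 (1.1), §3.4, §3.9, §4.9] [claim: Mochizuki2012, status: disputed] -/
theorem cor312NonarchOf_of_ledgerAtDatum_outerUnit {P : NFPoint} {l : ℕ} (T : Cor22.ThetaVolumeDatumAt P l)
    (huni : letI := T.instFieldF; letI := T.instNumberFieldF; letI := T.instAlgebraF; letI := T.instFieldK;
        letI := T.instNumberFieldK; letI := T.instAlgebraK; letI := T.instFieldFbar; letI := T.instAlgebraFbar;
        letI := T.instAlgebraKFbar; letI := T.instIsElliptic;
      ∀ (pp : Nat.Primes) (w x : (thetaIndex (pilotDataOfK T.D T.K)).Fibre (.inr pp)), haveI : Fact (pp : ℕ).Prime := ⟨pp.2⟩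
        placeOf (pilotDataOfK T.D T.K) pp.1 w ∈ (pilotDataOfK T.D T.K).S →
          (placeOf (pilotDataOfK T.D T.K) pp.1 x).asIdeal.ramificationIdx ℤ = (placeOf (pilotDataOfK T.D T.K) pp.1 w).asIdeal.ramificationIdx ℤ)
    (hO : letI := T.instFieldF; letI := T.instNumberFieldF; letI := T.instAlgebraF; letI := T.instFieldK;
        letI := T.instNumberFieldK; letI := T.instAlgebraK; letI := T.instFieldFbar; letI := T.instAlgebraFbar;
        letI := T.instAlgebraKFbar; letI := T.instIsElliptic;
      ∀ (pp : Nat.Primes) (w : (thetaIndex (pilotDataOfK T.D T.K)).Fibre (.inr pp)), haveI : Fact (pp : ℕ).Prime := ⟨pp.2⟩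
        placeOf (pilotDataOfK T.D T.K) pp.1 w ∈ (pilotDataOfK T.D T.K).S →
          (∀ a : ℕ, (((placeOf (pilotDataOfK T.D T.K) pp.1 w).asIdeal.ramificationIdx ℤ : ℕ) : ℤ) ≠
              ((pp : ℕ) : ℤ) ^ a * (((pp : ℕ) : ℤ) - 1)) ∨
            ∀ x : (thetaIndex (pilotDataOfK T.D T.K)).Fibre (.inr pp),
              2 ≤ (placeOf (pilotDataOfK T.D T.K) pp.1 x).asIdeal.inertiaDeg ℤ ∨
                ∃ π : kOf (pilotDataOfK T.D T.K) pp.1 x,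
                  ‖π‖ = ((pp : ℕ) : ℝ) ^ (-(1 : ℝ) / ((placeOf (pilotDataOfK T.D T.K) pp.1 w).asIdeal.ramificationIdx ℤ : ℝ)) ∧
                    ‖1 + π ^ ((placeOf (pilotDataOfK T.D T.K) pp.1 w).asIdeal.ramificationIdx ℤ) /
                      ((pp : ℕ) : kOf (pilotDataOfK T.D T.K) pp.1 x)‖ = 1)
    (hL : LedgerAtDatum T) :
    T.Cor312NonarchOf := by
  letI := T.instFieldF; letI := T.instNumberFieldF; letI := T.instAlgebraF; letI := T.instFieldK
  letI := T.instNumberFieldK; letI := T.instAlgebraK; letI := T.instFieldFbar; letI := T.instAlgebraFbar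
  letI := T.instAlgebraKFbar; letI := T.instIsElliptic
  haveI hne : ∀ pp : Nat.Primes, Fact (pp : ℕ).Prime := fun pp => ⟨pp.2⟩
  -- the q-pilot degrees are naturals (`P_w ≥ 1` on `S`, `0` off `S`)
  have hPex : ∀ (pp : Nat.Primes) (w : (thetaIndex (pilotDataOfK T.D T.K)).Fibre (.inr pp)),
      ∃ Pw : ℕ, (pilotDataOfK T.D T.K).qPilot (placeOf (pilotDataOfK T.D T.K) pp.1 w) = Pw := by
    intro pp w
    by_cases hw : placeOf (pilotDataOfK T.D T.K) pp.1 w ∈ (pilotDataOfK T.D T.K).S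
    · obtain ⟨Pw, hPw, -⟩ := exists_nat_qPilot_pilotDataOfK T.D hw
      exact ⟨Pw, hPw⟩
    · exact ⟨0, by rw [PilotData.qPilot_apply_of_not_mem (pilotDataOfK T.D T.K) hw, Nat.cast_zero]⟩
  choose Pw hPw using hPex
  have hH : HStarReachLedgerK T.D
      (fun pp w => (placeOf (pilotDataOfK T.D T.K) pp.1 w).asIdeal.ramificationIdx ℤ) (fun pp w => (Pw pp w : ℤ)) :=
    (ledgerAtDatum_iff_hStarReachLedgerK T Pw hPw).1 hL
  -- the index at a bad prime, read off any bad fibre point (junk `0` at a prime with no bad place — never read)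
  let eK : Nat.Primes → ℕ := fun pp =>
    if h : ∃ w : (thetaIndex (pilotDataOfK T.D T.K)).Fibre (.inr pp), placeOf (pilotDataOfK T.D T.K) pp.1 w ∈ (pilotDataOfK T.D T.K).S then
      (placeOf (pilotDataOfK T.D T.K) pp.1 h.choose).asIdeal.ramificationIdx ℤ else 0
  have heK : ∀ (pp : Nat.Primes) (w : (thetaIndex (pilotDataOfK T.D T.K)).Fibre (.inr pp)),
      placeOf (pilotDataOfK T.D T.K) pp.1 w ∈ (pilotDataOfK T.D T.K).S → ∀ x : (thetaIndex (pilotDataOfK T.D T.K)).Fibre (.inr pp),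
        (placeOf (pilotDataOfK T.D T.K) pp.1 x).asIdeal.ramificationIdx ℤ = eK pp := by
    intro pp w hw x
    have h : ∃ w : (thetaIndex (pilotDataOfK T.D T.K)).Fibre (.inr pp), placeOf (pilotDataOfK T.D T.K) pp.1 w ∈ (pilotDataOfK T.D T.K).S :=
      ⟨w, hw⟩
    show _ = (if h : ∃ w : (thetaIndex (pilotDataOfK T.D T.K)).Fibre (.inr pp), placeOf (pilotDataOfK T.D T.K) pp.1 w ∈ (pilotDataOfK T.D T.K).S
      then (placeOf (pilotDataOfK T.D T.K) pp.1 h.choose).asIdeal.ramificationIdx ℤ else 0)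
    rw [dif_pos h, huni pp _ x h.choose_spec]
  have hst := statement_pilotDataOfK_of_hStarReachLedgerK_of_innerOuterUnit T.D (logvAnalytic_analyticLogv (F := T.K)) (M P l T)
    (archPk P l T) (archSub P l T) (Ψ P l T) (act P l T) (Mmod P l T) (region P l T) (n P l T) (lat P l T) (sig P l T) (split P l T)
    (qData P l T) (exists_realising_qIdeles_pilotDataOfK T.D).choose (exists_realising_thetaIdeles_pilotDataOfK T.D).choose
    (exists_realising_qIdeles_pilotDataOfK T.D).choose_spec.1 (exists_realising_qIdeles_pilotDataOfK T.D).choose_spec.2.1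
    (exists_realising_thetaIdeles_pilotDataOfK T.D).choose_spec.1 (exists_realising_thetaIdeles_pilotDataOfK T.D).choose_spec.2.1
    (exists_realising_thetaIdeles_pilotDataOfK T.D).choose_spec.2.2 (exists_realising_qIdeles_pilotDataOfK T.D).choose_spec.2.2
    (fun pp w => (Pw pp w : ℤ)) eK heK
    (fun pp w hw => Or.inl (ne_two_and_ne_l_of_placeOf_mem_S_pilotDataOfK T.D pp w hw).1)
    (fun pp w hw => by rw [← heK pp w hw w]; exact hO pp w hw)
    (fun pp w _ => by rw [Int.cast_natCast]; exact (hPw pp w).symm) hH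
  exact (GenuineKStatement.statement_chosen_iff_cor312NonarchOf M archPk archSub Ψ act Mmod region n lat sig split qData T).1 hst

include M archPk archSub Ψ act Mmod region n lat sig split qData in
/-- **`K/ℚ` GALOIS rows: `LedgerAtDatum T` ∧ (O″) ⟹ `T.Cor312NonarchOf`** — (U) discharged by `ramificationIdx_placeOf_eq_of_isGalois`.
[cite: NeukirchANT1999, Ch. I §9 (9.1), Ch. II (5.5)–(5.7)] [claim: Mochizuki2012, status: disputed] -/
theorem cor312NonarchOf_of_ledgerAtDatum_outerUnit_of_isGalois {P : NFPoint} {l : ℕ} (T : Cor22.ThetaVolumeDatumAt P l)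
    (hgal : letI := T.instFieldF; letI := T.instNumberFieldF; letI := T.instAlgebraF; letI := T.instFieldK;
        letI := T.instNumberFieldK; letI := T.instAlgebraK; letI := T.instFieldFbar; letI := T.instAlgebraFbar;
        letI := T.instAlgebraKFbar; letI := T.instIsElliptic; IsGalois ℚ T.K)
    (hO : letI := T.instFieldF; letI := T.instNumberFieldF; letI := T.instAlgebraF; letI := T.instFieldK;
        letI := T.instNumberFieldK; letI := T.instAlgebraK; letI := T.instFieldFbar; letI := T.instAlgebraFbar;
        letI := T.instAlgebraKFbar; letI := T.instIsElliptic;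
      ∀ (pp : Nat.Primes) (w : (thetaIndex (pilotDataOfK T.D T.K)).Fibre (.inr pp)), haveI : Fact (pp : ℕ).Prime := ⟨pp.2⟩
        placeOf (pilotDataOfK T.D T.K) pp.1 w ∈ (pilotDataOfK T.D T.K).S →
          (∀ a : ℕ, (((placeOf (pilotDataOfK T.D T.K) pp.1 w).asIdeal.ramificationIdx ℤ : ℕ) : ℤ) ≠
              ((pp : ℕ) : ℤ) ^ a * (((pp : ℕ) : ℤ) - 1)) ∨
            ∀ x : (thetaIndex (pilotDataOfK T.D T.K)).Fibre (.inr pp),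
              2 ≤ (placeOf (pilotDataOfK T.D T.K) pp.1 x).asIdeal.inertiaDeg ℤ ∨
                ∃ π : kOf (pilotDataOfK T.D T.K) pp.1 x,
                  ‖π‖ = ((pp : ℕ) : ℝ) ^ (-(1 : ℝ) / ((placeOf (pilotDataOfK T.D T.K) pp.1 w).asIdeal.ramificationIdx ℤ : ℝ)) ∧
                    ‖1 + π ^ ((placeOf (pilotDataOfK T.D T.K) pp.1 w).asIdeal.ramificationIdx ℤ) /
                      ((pp : ℕ) : kOf (pilotDataOfK T.D T.K) pp.1 x)‖ = 1)
    (hL : LedgerAtDatum T) :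
    T.Cor312NonarchOf := by
  letI := T.instFieldF; letI := T.instNumberFieldF; letI := T.instAlgebraF; letI := T.instFieldK
  letI := T.instNumberFieldK; letI := T.instAlgebraK; letI := T.instFieldFbar; letI := T.instAlgebraFbar
  letI := T.instAlgebraKFbar; letI := T.instIsElliptic
  haveI := hgal
  exact cor312NonarchOf_of_ledgerAtDatum_outerUnit M archPk archSub Ψ act Mmod region n lat sig split qData T
    (fun pp w x _ => ramificationIdx_placeOf_eq_of_isGalois (pilotDataOfK T.D T.K) pp w x) hO hL

include M archPk archSub Ψ act Mmod region n lat sig split qData in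
/-- **`K2Target27` with the outer tie read off ONE uniformizer — from ONE structural hypothesis: every Σ₂₇ datum (antecedents of `K2Target27`
VERBATIM) satisfies (U) and (O″) at its bad primes.** Explicit 1. The residual of row 27's certificate binder is thus exactly the Σ₂₇ data with a
bad prime of cyclotomic index (`l ∣ p − 1`) carrying a residue-degree-`1` place of cyclotomic type. [cite: NeukirchANT1999, Ch. II (5.5)–(5.7)]
[cite: Mochizuki2012, IUTchI Def. 3.1 (b) p. 61] [claim: Mochizuki2012, status: disputed] -/
theorem k2Target27_of_outerUnit
    (hUO : ∀ (P : NFPoint), P ∈ UP → ∀ (l : ℕ), l.Prime → 5 ≤ l →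
      Cor22.AdmitsCore P → Cor22.CondP2 P l → Cor22.CondP5 P l → Cor22.CondP6 P l →
      (((l : ℝ) + 5) / 4 < (Cor22.dmod P : ℝ) ∨
        6 * l * (((l : ℝ) + 5) - 4 * Cor22.dmod P) / (((l : ℝ) + 4) * ((l : ℝ) - 3))
            * (P.logDiff + (1 - 1 / (l : ℝ)) * Cor22.logCondAvoid P {2, l})
          + 6 * l * ((l : ℝ) + 5) / (((l : ℝ) + 4) * ((l : ℝ) - 3)) * Real.log Real.pi < Cor22.logQAvoid P {2, l}) →
      ∀ (T : Cor22.ThetaVolumeDatumAt P l), letI := T.instFieldF; letI := T.instNumberFieldF; letI := T.instAlgebraF; letI := T.instFieldK;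
        letI := T.instNumberFieldK; letI := T.instAlgebraK; letI := T.instFieldFbar; letI := T.instAlgebraFbar;
        letI := T.instAlgebraKFbar; letI := T.instIsElliptic;
      ¬ (∃ (pp : Nat.Primes) (_ : 2 < (pp : ℕ)) (i : Fin (thetaIndex (pilotDataOfK T.D T.K)).lstar)
          (x₀ : (thetaIndex (pilotDataOfK T.D T.K)).Fibre (.inr pp)),
        haveI : Fact (pp : ℕ).Prime := ⟨pp.2⟩
        ((pp : ℕ) : ℝ) ^ ((((i : ℕ) : ℝ) + 2) * (4 + 2 * Real.logb (pp : ℕ) (Module.finrank ℚ T.K)) + 1) *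
          ‖(exists_realising_qIdeles_pilotDataOfK T.D).choose pp x₀‖ ^ (((i : ℕ) + 1) ^ 2 - 1) < 1) →
      (∀ (pp : Nat.Primes) (w x : (thetaIndex (pilotDataOfK T.D T.K)).Fibre (.inr pp)), haveI : Fact (pp : ℕ).Prime := ⟨pp.2⟩
        placeOf (pilotDataOfK T.D T.K) pp.1 w ∈ (pilotDataOfK T.D T.K).S →
          (placeOf (pilotDataOfK T.D T.K) pp.1 x).asIdeal.ramificationIdx ℤ = (placeOf (pilotDataOfK T.D T.K) pp.1 w).asIdeal.ramificationIdx ℤ) ∧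
        (∀ (pp : Nat.Primes) (w : (thetaIndex (pilotDataOfK T.D T.K)).Fibre (.inr pp)), haveI : Fact (pp : ℕ).Prime := ⟨pp.2⟩
        placeOf (pilotDataOfK T.D T.K) pp.1 w ∈ (pilotDataOfK T.D T.K).S →
          (∀ a : ℕ, (((placeOf (pilotDataOfK T.D T.K) pp.1 w).asIdeal.ramificationIdx ℤ : ℕ) : ℤ) ≠
              ((pp : ℕ) : ℤ) ^ a * (((pp : ℕ) : ℤ) - 1)) ∨
            ∀ x : (thetaIndex (pilotDataOfK T.D T.K)).Fibre (.inr pp),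
              2 ≤ (placeOf (pilotDataOfK T.D T.K) pp.1 x).asIdeal.inertiaDeg ℤ ∨
                ∃ π : kOf (pilotDataOfK T.D T.K) pp.1 x,
                  ‖π‖ = ((pp : ℕ) : ℝ) ^ (-(1 : ℝ) / ((placeOf (pilotDataOfK T.D T.K) pp.1 w).asIdeal.ramificationIdx ℤ : ℝ)) ∧
                    ‖1 + π ^ ((placeOf (pilotDataOfK T.D T.K) pp.1 w).asIdeal.ramificationIdx ℤ) /
                      ((pp : ℕ) : kOf (pilotDataOfK T.D T.K) pp.1 x)‖ = 1)) :
    K2Target27 := by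
  intro P hP l hl h5 hc h2 h5' h6 hbad T hwin hL
  obtain ⟨huni, hO⟩ := hUO P hP l hl h5 hc h2 h5' h6 hbad T hwin
  exact cor312NonarchOf_of_ledgerAtDatum_outerUnit M archPk archSub Ψ act Mmod region n lat sig split qData T huni hO hL

include M archPk archSub Ψ act Mmod region n lat sig split qData in
/-- **`K2Target27` on the `K/ℚ`-GALOIS stratum with the outer tie read off ONE uniformizer** — from ONE hypothesis: every Σ₂₇ datum has `K/ℚ`
Galois and (O″) at its bad primes. Explicit 1. [cite: NeukirchANT1999, Ch. I §9 (9.1), Ch. II (5.5)–(5.7)] [claim: Mochizuki2012, status: disputed] -/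
theorem k2Target27_of_isGalois_outerUnit
    (hGO : ∀ (P : NFPoint), P ∈ UP → ∀ (l : ℕ), l.Prime → 5 ≤ l →
      Cor22.AdmitsCore P → Cor22.CondP2 P l → Cor22.CondP5 P l → Cor22.CondP6 P l →
      (((l : ℝ) + 5) / 4 < (Cor22.dmod P : ℝ) ∨
        6 * l * (((l : ℝ) + 5) - 4 * Cor22.dmod P) / (((l : ℝ) + 4) * ((l : ℝ) - 3))
            * (P.logDiff + (1 - 1 / (l : ℝ)) * Cor22.logCondAvoid P {2, l})
          + 6 * l * ((l : ℝ) + 5) / (((l : ℝ) + 4) * ((l : ℝ) - 3)) * Real.log Real.pi < Cor22.logQAvoid P {2, l}) →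
      ∀ (T : Cor22.ThetaVolumeDatumAt P l), letI := T.instFieldF; letI := T.instNumberFieldF; letI := T.instAlgebraF; letI := T.instFieldK;
        letI := T.instNumberFieldK; letI := T.instAlgebraK; letI := T.instFieldFbar; letI := T.instAlgebraFbar;
        letI := T.instAlgebraKFbar; letI := T.instIsElliptic;
      ¬ (∃ (pp : Nat.Primes) (_ : 2 < (pp : ℕ)) (i : Fin (thetaIndex (pilotDataOfK T.D T.K)).lstar)
          (x₀ : (thetaIndex (pilotDataOfK T.D T.K)).Fibre (.inr pp)),
        haveI : Fact (pp : ℕ).Prime := ⟨pp.2⟩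
        ((pp : ℕ) : ℝ) ^ ((((i : ℕ) : ℝ) + 2) * (4 + 2 * Real.logb (pp : ℕ) (Module.finrank ℚ T.K)) + 1) *
          ‖(exists_realising_qIdeles_pilotDataOfK T.D).choose pp x₀‖ ^ (((i : ℕ) + 1) ^ 2 - 1) < 1) →
      IsGalois ℚ T.K ∧
        (∀ (pp : Nat.Primes) (w : (thetaIndex (pilotDataOfK T.D T.K)).Fibre (.inr pp)), haveI : Fact (pp : ℕ).Prime := ⟨pp.2⟩
        placeOf (pilotDataOfK T.D T.K) pp.1 w ∈ (pilotDataOfK T.D T.K).S →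
          (∀ a : ℕ, (((placeOf (pilotDataOfK T.D T.K) pp.1 w).asIdeal.ramificationIdx ℤ : ℕ) : ℤ) ≠
              ((pp : ℕ) : ℤ) ^ a * (((pp : ℕ) : ℤ) - 1)) ∨
            ∀ x : (thetaIndex (pilotDataOfK T.D T.K)).Fibre (.inr pp),
              2 ≤ (placeOf (pilotDataOfK T.D T.K) pp.1 x).asIdeal.inertiaDeg ℤ ∨
                ∃ π : kOf (pilotDataOfK T.D T.K) pp.1 x,
                  ‖π‖ = ((pp : ℕ) : ℝ) ^ (-(1 : ℝ) / ((placeOf (pilotDataOfK T.D T.K) pp.1 w).asIdeal.ramificationIdx ℤ : ℝ)) ∧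
                    ‖1 + π ^ ((placeOf (pilotDataOfK T.D T.K) pp.1 w).asIdeal.ramificationIdx ℤ) /
                      ((pp : ℕ) : kOf (pilotDataOfK T.D T.K) pp.1 x)‖ = 1)) :
    K2Target27 := by
  intro P hP l hl h5 hc h2 h5' h6 hbad T hwin hL
  obtain ⟨hgal, hO⟩ := hGO P hP l hl h5 hc h2 h5' h6 hbad T hwin
  exact cor312NonarchOf_of_ledgerAtDatum_outerUnit_of_isGalois M archPk archSub Ψ act Mmod region n lat sig split qData T hgal hO hL

end KFamily

end Summit.ABC.IUTFork.Repair.RH.ReachLedgerQ2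

end
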